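import Literature.AlgebraicGeometry.Kawanoue2007.IdealisticFiltrationSaturation
import HarnessLib

/-!
# Kawanoue 2007, Part I, Def. 1.2.2.1 and the logarithmic variants 𝔇_E / 𝔅_E of Def. 2.1.2.1 / 2.1.5.1

H. Kawanoue, *Toward resolution of singularities over a field of positive characteristic. Part I.
Foundation; the language of the idealistic filtration*, Publ. RIMS **43** (2007) 819–909
(= arXiv:math/0607009) [Kawanoue2007]. Sequel of `IdealisticFiltrationSaturation.lean` (which typed
the 𝔇-saturation for an ARBITRARY graded operator family, `IsSaturatedFor`, and announced the
logarithmic variant as «`IsSaturatedFor` on the logarithmic operators once those are available»).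
This file supplies them:

> **Definition 1.2.2.1.** «Let `E` be a simple normal crossing divisor on `Spec R`, and `I_E ⊂ R` its
> defining ideal. We define the set `Diff^n_{R,E}` of the logarithmic differential operators of degree
> `≤ n` on `R` with respect to `E` by `Diff^n_{R,E} = { d ∈ Diff^n_R ; d(I_E^t) ⊂ I_E^t ∀ t ∈ ℤ_{≥0} }`.»
>
> **Def. 2.1.2.1 (second half).** «Replacing condition (differential) with condition (differential)_E,
> [`(f, a) ∈ 𝕀, d ∈ Diff^t_{R,E} ⟹ (d(f), a − t) ∈ 𝕀`], we obtain the notion of an idealistic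
> filtration being 𝔇_E-saturated and that of the 𝔇_E-saturation.»
>
> **Def. 2.1.5.1.** «… 𝔅_E-saturated if it is both 𝔇_E-saturated and ℜ-saturated … the 𝔅_E-saturation».

Typed for any commutative `k`-algebra `R` and ANY ideal `I` of `R` in the role of `I_E` (that `I`
defines a simple normal crossing divisor is a hypothesis the consumer carries; nothing here uses it):
`logDiffOp k I n = Diff^n_{R,E}` as an `R`-submodule of `End_k(R)` (with `Diff^n_R` = the tree's
`Resolution.diffOp k R n`, EGA IV₄ 16.8.8), `IsDESaturated k I`, `DESat k I = 𝔇_E(𝕀)`,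
`IsBESaturated k I`, `BESat k I = 𝔅_E(𝕀)`, each with Lemma 2.2.1.1 (1)(3) (stability under
intersections, containment, saturatedness, minimality) PROVED via `satBy`, and the comparison
`IsDSaturated → IsDESaturated` (as `Diff_{R,E} ⊂ Diff_R`). NO named facts. Pages re-read on the
held arXiv text (`lit read paper:arxiv-math-0607009`, chunks p0044, p0051–p0052, p0054–p0055).
Campaign `res-hironaka` (D-0089), rung LIT-6.

Deliberately NOT here: Lemma 1.2.2.2 (the basis `X^{J_E} ∂_{X^J}` of `Diff^n_{R,E}` for a regular
system of parameters adapted to `E`, and the logarithmic product formula), Prop. 2.4.2.x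
(`𝔅_E = 𝔇_E ℜ`).

## References

* H. Kawanoue, Publ. RIMS 43 (2007) 819–909 = arXiv:math/0607009: Def. 1.2.2.1, Def. 2.1.2.1,
  Def. 2.1.5.1, Lemma 2.2.1.1. [Kawanoue2007]
* A. Grothendieck, J. Dieudonné, ÉGA IV₄, Déf. 16.8.1 / Prop. 16.8.8 (the tree's `Resolution.diffOp`).
  [EGAIV4]
-/

namespace Literature.AlgebraicGeometry.Kawanoue2007

open Literature.AlgebraicGeometry.Resolution (IsDiffOpLE diffOp isDiffOpLE_mulLeft)

/-! ## Def. 1.2.2.1: logarithmic differential operators with respect to an ideal -/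

section LogDiff

variable (k : Type*) {R : Type*} [CommRing k] [CommRing R] [Algebra k R]

/-- **`Diff^n_{R,E}`, the logarithmic differential operators of degree `≤ n` with respect to the ideal
`I = I_E`**: «`{ d ∈ Diff^n_R ; d(I_E^t) ⊂ I_E^t ∀ t ∈ ℤ_{≥0} }`», as an `R`-submodule of `End_k(R)`
(`R` acting by post-multiplication, as for the tree's `diffOp`). [cite: Kawanoue2007, Def. 1.2.2.1] -/
def logDiffOp (I : Ideal R) (n : ℕ) : Submodule R (R →ₗ[k] R) where
  carrier := {d | IsDiffOpLE k n d ∧ ∀ (t : ℕ) (f : R), f ∈ I ^ t → d f ∈ I ^ t}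
  zero_mem' := ⟨(diffOp k R n).zero_mem, fun t _ _ => by simp⟩
  add_mem' := fun {d d'} hd hd' =>
    ⟨(diffOp k R n).add_mem hd.1 hd'.1, fun t f hf => by
      simpa using (I ^ t).add_mem (hd.2 t f hf) (hd'.2 t f hf)⟩
  smul_mem' := fun r {d} hd =>
    ⟨(diffOp k R n).smul_mem r hd.1, fun t f hf => by
      simpa using (I ^ t).mul_mem_left r (hd.2 t f hf)⟩

/-- Membership in `Diff^n_{R,E}`. [cite: Kawanoue2007, Def. 1.2.2.1] -/
theorem mem_logDiffOp_iff {I : Ideal R} {n : ℕ} {d : R →ₗ[k] R} :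
    d ∈ logDiffOp k I n ↔ IsDiffOpLE k n d ∧ ∀ (t : ℕ) (f : R), f ∈ I ^ t → d f ∈ I ^ t :=
  Iff.rfl

/-- `Diff^n_{R,E} ⊂ Diff^n_R`. [cite: Kawanoue2007, Def. 1.2.2.1] -/
theorem logDiffOp_le_diffOp (I : Ideal R) (n : ℕ) : logDiffOp k I n ≤ diffOp k R n :=
  fun _ hd => hd.1

/-- `Diff^n_{R,E} ⊂ Diff^{n'}_{R,E}` for `n ≤ n'`. [cite: Kawanoue2007, Def. 1.2.2.1] -/
theorem logDiffOp_mono (I : Ideal R) {n n' : ℕ} (h : n ≤ n') : logDiffOp k I n ≤ logDiffOp k I n' :=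
  fun _ hd => ⟨IsDiffOpLE.of_le h hd.1, hd.2⟩

/-- Multiplications `f ↦ b f` are logarithmic operators of degree `≤ 0` (hence of every degree).
[cite: Kawanoue2007, Def. 1.2.2.1] -/
theorem mulLeft_mem_logDiffOp (I : Ideal R) (b : R) (n : ℕ) :
    LinearMap.mulLeft k b ∈ logDiffOp k I n :=
  ⟨IsDiffOpLE.of_le (Nat.zero_le n) (isDiffOpLE_mulLeft b),
    fun t f hf => by simpa using (I ^ t).mul_mem_left b hf⟩

/-- For `I = R` (empty divisor) every differential operator is logarithmic.
[cite: Kawanoue2007, Def. 1.2.2.1] -/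
theorem logDiffOp_top (n : ℕ) : logDiffOp k (⊤ : Ideal R) n = diffOp k R n := by
  refine le_antisymm (logDiffOp_le_diffOp k ⊤ n) fun d hd => ⟨hd, fun t f _ => ?_⟩
  rw [Ideal.top_pow]; trivial

end LogDiff

/-! ## Def. 2.1.2.1 (differential)_E and Def. 2.1.5.1 𝔅_E -/

namespace IdealisticFiltration

variable (k : Type*) {R : Type*} [CommRing k] [CommRing R] [Algebra k R]

/-- **𝔇_E-saturated** [Def. 2.1.2.1, condition (differential)_E]: «`(f, a) ∈ 𝕀, d ∈ Diff^t_{R,E} ⟹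
(d(f), a − t) ∈ 𝕀`» — `IsSaturatedFor` on the logarithmic operators w.r.t. the ideal `I = I_E`.
[cite: Kawanoue2007, Def. 2.1.2.1] -/
def IsDESaturated (I : Ideal R) (𝕀 : IdealisticFiltration R) : Prop :=
  IsSaturatedFor k (fun t => (logDiffOp k I t : Set (R →ₗ[k] R))) 𝕀

/-- Unfolding of `IsDESaturated`. [cite: Kawanoue2007, Def. 2.1.2.1] -/
theorem isDESaturated_iff (I : Ideal R) (𝕀 : IdealisticFiltration R) :
    IsDESaturated k I 𝕀 ↔ ∀ (t : ℕ) (d : R →ₗ[k] R), d ∈ logDiffOp k I t →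
      ∀ (a : ℝ) (f : R), f ∈ 𝕀.level a → d f ∈ 𝕀.level (a - t) :=
  Iff.rfl

/-- A 𝔇-saturated filtration is 𝔇_E-saturated (`Diff_{R,E} ⊂ Diff_R`). [cite: Kawanoue2007, Def. 2.1.2.1] -/
theorem IsDSaturated.isDESaturated {𝕀 : IdealisticFiltration R} (h : IsDSaturated k 𝕀) (I : Ideal R) :
    IsDESaturated k I 𝕀 :=
  fun t d hd a f hf => h t d hd.1 a f hf

/-- 𝔇_E-saturated filtrations are stable under intersections. [cite: Kawanoue2007, Lemma 2.2.1.1 (1)] -/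
theorem isDESaturated_inter (I : Ideal R) (S : Set (IdealisticFiltration R))
    (hS : ∀ 𝕁 ∈ S, IsDESaturated k I 𝕁) : IsDESaturated k I (inter S) :=
  isSaturatedFor_inter k _ S hS

/-- **`𝔇_E(𝕀)`, the 𝔇_E-saturation**: the minimal 𝔇_E-saturated idealistic filtration containing `𝕀`.
[cite: Kawanoue2007, Def. 2.1.2.1 and Lemma 2.2.1.1 (3)] -/
def DESat (I : Ideal R) (𝕀 : IdealisticFiltration R) : IdealisticFiltration R :=
  satBy (IsDESaturated k I) 𝕀

/-- `𝕀 ⊂ 𝔇_E(𝕀)`, `𝔇_E(𝕀)` is 𝔇_E-saturated, and it is minimal. [cite: Kawanoue2007, Def. 2.1.2.1] -/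
theorem DESat_spec (I : Ideal R) (𝕀 : IdealisticFiltration R) :
    Incl 𝕀 (DESat k I 𝕀) ∧ IsDESaturated k I (DESat k I 𝕀) ∧
      ∀ 𝕁 : IdealisticFiltration R, Incl 𝕀 𝕁 → IsDESaturated k I 𝕁 → Incl (DESat k I 𝕀) 𝕁 :=
  ⟨incl_satBy _ 𝕀, satBy_prop (isDESaturated_inter k I) 𝕀, fun _ h h𝕁 => satBy_incl h h𝕁⟩

/-- `𝔇_E(𝕀) = 𝕀` for a 𝔇_E-saturated `𝕀`. [cite: Kawanoue2007, Def. 2.1.2.1] -/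
theorem DESat_eq_self {I : Ideal R} {𝕀 : IdealisticFiltration R} (h : IsDESaturated k I 𝕀) :
    DESat k I 𝕀 = 𝕀 :=
  satBy_eq_self h

/-- `𝔇_E` is monotone. [cite: Kawanoue2007, Def. 2.1.2.1] -/
theorem DESat_mono (I : Ideal R) {𝕀 𝕁 : IdealisticFiltration R} (h : Incl 𝕀 𝕁) :
    Incl (DESat k I 𝕀) (DESat k I 𝕁) :=
  satBy_mono (isDESaturated_inter k I) h

/-- `𝔇_E(𝕀) ⊂ 𝔇(𝕀)` (the 𝔇-saturation is 𝔇_E-saturated). [cite: Kawanoue2007, Def. 2.1.2.1] -/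
theorem DESat_incl_DSat (I : Ideal R) (𝕀 : IdealisticFiltration R) : Incl (DESat k I 𝕀) (DSat k 𝕀) :=
  (DESat_spec k I 𝕀).2.2 _ (incl_DSat k 𝕀) ((isDSaturated_DSat k 𝕀).isDESaturated k I)

/-- **𝔅_E-saturated** = «both 𝔇_E-saturated and ℜ-saturated». [cite: Kawanoue2007, Def. 2.1.5.1] -/
def IsBESaturated (I : Ideal R) (𝕀 : IdealisticFiltration R) : Prop :=
  IsDESaturated k I 𝕀 ∧ IsRSaturated 𝕀

/-- 𝔅_E-saturated filtrations are stable under intersections. [cite: Kawanoue2007, Lemma 2.2.1.1 (1)] -/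
theorem isBESaturated_inter (I : Ideal R) (S : Set (IdealisticFiltration R))
    (hS : ∀ 𝕁 ∈ S, IsBESaturated k I 𝕁) : IsBESaturated k I (inter S) :=
  ⟨isDESaturated_inter k I S fun 𝕁 h => (hS 𝕁 h).1, isRSaturated_inter S fun 𝕁 h => (hS 𝕁 h).2⟩

/-- **`𝔅_E(𝕀)`, the 𝔅_E-saturation**: the minimal 𝔅_E-saturated idealistic filtration containing `𝕀`.
[cite: Kawanoue2007, Def. 2.1.5.1 and Lemma 2.2.1.1 (3)] -/
def BESat (I : Ideal R) (𝕀 : IdealisticFiltration R) : IdealisticFiltration R :=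
  satBy (IsBESaturated k I) 𝕀

/-- `𝕀 ⊂ 𝔅_E(𝕀)`, `𝔅_E(𝕀)` is 𝔅_E-saturated, and it is minimal. [cite: Kawanoue2007, Def. 2.1.5.1] -/
theorem BESat_spec (I : Ideal R) (𝕀 : IdealisticFiltration R) :
    Incl 𝕀 (BESat k I 𝕀) ∧ IsBESaturated k I (BESat k I 𝕀) ∧
      ∀ 𝕁 : IdealisticFiltration R, Incl 𝕀 𝕁 → IsBESaturated k I 𝕁 → Incl (BESat k I 𝕀) 𝕁 :=
  ⟨incl_satBy _ 𝕀, satBy_prop (isBESaturated_inter k I) 𝕀, fun _ h h𝕁 => satBy_incl h h𝕁⟩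

/-- A 𝔅-saturated filtration is 𝔅_E-saturated; hence `𝔅_E(𝕀) ⊂ 𝔅(𝕀)`. [cite: Kawanoue2007, Def. 2.1.5.1] -/
theorem BESat_incl_BSat (I : Ideal R) (𝕀 : IdealisticFiltration R) : Incl (BESat k I 𝕀) (BSat k 𝕀) :=
  (BESat_spec k I 𝕀).2.2 _ (BSat_spec k 𝕀).1
    ⟨((BSat_spec k 𝕀).2.1.1).isDESaturated k I, (BSat_spec k 𝕀).2.1.2⟩

end IdealisticFiltration

end Literature.AlgebraicGeometry.Kawanoue2007
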